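import Literature.Probability.Percolation.TriMarkedSandwich
import Literature.Probability.Percolation.Crossings

/-!
# The cell/site sandwich for marked discrete domains straddling the arcs (support item `SmirnovCellAnchor`)

Helper file for `Summit.CriticalPhenomena.CardyFormulaZ2.Theses.ModulusResponse.SmirnovCellAnchor`
(stmt-CriticalPhenomena-6471). Cell/site port of `TriMarkedSandwich.lean` (Bollobás–Riordan 2006,
Ch. 7, Lemma 14 (19) p. 184 with Claims 19–20 p. 192 and the remark p. 195): the open crossing
probability of a 4-marked discrete domain `G⁻` of `δ𝕋` straddling `W.arc 0 ∪ W.arc 2` (sites off `W`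
hug these arcs, sites in `W` away from the corners keep `8δ`-off `W.arc 1 ∪ W.arc 3`, the first and
third discrete arcs lie off `W`) is at most the cell crossing probability of `Q` plus the four open
corner terms (`openCrossingProb_le_cell_add`); dually the cell crossing probability is at most the
open crossing probability of a domain `G⁺` straddling `W.arc 1 ∪ W.arc 3` plus the closed corner
terms (`cell_le_openCrossingProb_add`, through Lemma 5 `tri_markedDomain_duality_holds`). The
pathwise input is abstracted as the hypothesis `hL` / `hU`, which is the probability form of
`…SandwichPaths` for `W` itself (direct orientation) or for a rectangle whose conjugate is `g(Q)`
(the reflected case); the statements are otherwise those of the tree with the modified margins.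
-/

noncomputable section

namespace Summit.CriticalPhenomena.CardyFormulaZ2.Theorems.SmirnovCellAnchor

open Set Metric MeasureTheory
open Literature.Probability.Percolation Literature.Probability.LatticeModels
  Literature.Probability.RandomPlanarGeometry

variable (Φ : Set (Site 2) → BondConfig (Site 2)) (Q W : ConformalRectangle)

/-- **Lower half of (19) with corner terms, cell/site version** (see the module docstring).
[cite: BollobasRiordan2006, Ch. 7 Lemma 14 (19), Claims 19–20 p. 192, p. 195] -/
theorem openCrossingProb_le_cell_add {ρ : ℝ}
    (hL : ∃ δ₀ > 0, ∃ t₀ > 0, ∀ δ t : ℝ, 0 < δ → δ < δ₀ → 0 ≤ t → t ≤ t₀ →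
      ∀ (p : unitInterval) (V U₀ U₂ : Set (Site 2)),
        (∀ x ∈ V, triMeshPoint δ x ∉ W.carrier →
          infDist (triMeshPoint δ x) (W.arc 0) ≤ t ∨ infDist (triMeshPoint δ x) (W.arc 2) ≤ t) →
        (∀ x ∈ V, triMeshPoint δ x ∈ W.carrier →
          8 * δ < infDist (triMeshPoint δ x) (W.arc 1) ∧ 8 * δ < infDist (triMeshPoint δ x) (W.arc 3)) →
        (∀ x ∈ V, ∀ j : Fin 4, ρ ≤ dist (triMeshPoint δ x) (W.pt j)) →
        (∀ u ∈ U₀, triMeshPoint δ u ∉ W.carrier ∧ infDist (triMeshPoint δ u) (W.arc 0) ≤ t) →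
        (∀ v ∈ U₂, triMeshPoint δ v ∉ W.carrier ∧ infDist (triMeshPoint δ v) (W.arc 2) ≤ t) →
        (triSitePercolation p).real {ω | ∃ u ∈ U₀, ∃ v ∈ U₂, PathIn triGraph (V ∩ ω) u v} ≤
          (triSitePercolation p).real {ω | Φ ω ∈ discreteCrossing Q.carrier δ (Q.arc 0) (Q.arc 2)}) :
    ∃ δ₀ > 0, ∃ t₀ > 0, ∀ δ t : ℝ, 0 < δ → δ < δ₀ → 0 ≤ t → t ≤ t₀ → ∀ {r₁ r₂ : ℝ}, ρ ≤ r₁ →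
      ∀ G : TriMarkedDomain 4,
        (∀ x ∈ G.verts, triMeshPoint δ x ∉ W.carrier →
          infDist (triMeshPoint δ x) (W.arc 0) ≤ t ∨ infDist (triMeshPoint δ x) (W.arc 2) ≤ t) →
        (∀ x ∈ G.verts, triMeshPoint δ x ∈ W.carrier → (∀ i, ρ ≤ dist (triMeshPoint δ x) (W.pt i)) →
          8 * δ < infDist (triMeshPoint δ x) (W.arc 1) ∧ 8 * δ < infDist (triMeshPoint δ x) (W.arc 3)) →
        (∀ u ∈ G.arc 0, (∀ i, ρ ≤ dist (triMeshPoint δ u) (W.pt i)) →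
          triMeshPoint δ u ∉ W.carrier ∧ infDist (triMeshPoint δ u) (W.arc 0) ≤ t) →
        (∀ v ∈ G.arc 2, (∀ i, ρ ≤ dist (triMeshPoint δ v) (W.pt i)) →
          triMeshPoint δ v ∉ W.carrier ∧ infDist (triMeshPoint δ v) (W.arc 2) ≤ t) →
        (∀ u ∈ G.arc 0, r₂ < dist (triMeshPoint δ u) (W.pt 2) ∧ r₂ < dist (triMeshPoint δ u) (W.pt 3)) →
        (∀ v ∈ G.arc 2, r₂ < dist (triMeshPoint δ v) (W.pt 0) ∧ r₂ < dist (triMeshPoint δ v) (W.pt 1)) →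
        G.openCrossingProb 0 2 ≤
          (triSitePercolation half).real {ω | Φ ω ∈ discreteCrossing Q.carrier δ (Q.arc 0) (Q.arc 2)} +
            ∑ i : Fin 4, (triSitePercolation half).real (triAnnulusCrossing true δ (W.pt i) r₁ r₂) := by
  classical
  obtain ⟨δ₀, hδ₀, t₀, ht₀, hsand⟩ := hL
  refine ⟨δ₀, hδ₀, t₀, ht₀, fun δ t hδ hδlt ht htle r₁ r₂ hρ G hout hin hU₀ hU₂ hfar0 hfar2 => ?_⟩
  -- the corner-avoiding sites and arcs
  set V : Set (Site 2) := {x | x ∈ G.verts ∧ ∀ i, ρ ≤ dist (triMeshPoint δ x) (W.pt i)} with hV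
  set U₀ : Set (Site 2) := {u | u ∈ G.arc 0 ∧ ∀ i, ρ ≤ dist (triMeshPoint δ u) (W.pt i)} with hU₀def
  set U₂ : Set (Site 2) := {v | v ∈ G.arc 2 ∧ ∀ i, ρ ≤ dist (triMeshPoint δ v) (W.pt i)} with hU₂def
  have hle := hsand δ t hδ hδlt ht htle half V U₀ U₂ (fun x hx => hout x hx.1) (fun x hx hxΩ => hin x hx.1 hxΩ hx.2)
    (fun x hx => hx.2) (fun u hu => hU₀ u hu.1 hu.2) (fun v hv => hU₂ v hv.1 hv.2)
  -- event inclusion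
  have hsub : G.openCrossing 0 2 ⊆ {ω | ∃ u ∈ U₀, ∃ v ∈ U₂, PathIn triGraph (V ∩ ω) u v} ∪
      ⋃ i : Fin 4, triAnnulusCrossing true δ (W.pt i) r₁ r₂ := by
    rintro ω ⟨u, hu, v, hv, hP⟩
    obtain ⟨P, hP⟩ := hP.exists_walk
    have hend : ∀ i : Fin 4, r₂ < dist (triMeshPoint δ u) (W.pt i) ∨ r₂ < dist (triMeshPoint δ v) (W.pt i) := by
      intro i
      match i with
      | 0 => exact Or.inr (hfar2 v hv).1
      | 1 => exact Or.inr (hfar2 v hv).2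
      | 2 => exact Or.inl (hfar0 u hu).1
      | 3 => exact Or.inl (hfar0 u hu).2
    rcases walk_far_or_annulus W hρ (c := true) (ω := ω) P (fun x hx => by simpa using (hP x hx).2) hend
      with hfar | ⟨i, hi⟩
    · refine Or.inl ⟨u, ⟨hu, hfar u P.start_mem_support⟩, v, ⟨hv, hfar v P.end_mem_support⟩, ?_⟩
      exact PathIn.of_walk P fun x hx => ⟨⟨(hP x hx).1, hfar x hx⟩, (hP x hx).2⟩
    · exact Or.inr (mem_iUnion.2 ⟨i, hi⟩)
  calc G.openCrossingProb 0 2 = (triSitePercolation half).real (G.openCrossing 0 2) := rfl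
    _ ≤ (triSitePercolation half).real ({ω | ∃ u ∈ U₀, ∃ v ∈ U₂, PathIn triGraph (V ∩ ω) u v} ∪
          ⋃ i : Fin 4, triAnnulusCrossing true δ (W.pt i) r₁ r₂) := measureReal_mono hsub (measure_ne_top _ _)
    _ ≤ (triSitePercolation half).real {ω | ∃ u ∈ U₀, ∃ v ∈ U₂, PathIn triGraph (V ∩ ω) u v} +
          (triSitePercolation half).real (⋃ i : Fin 4, triAnnulusCrossing true δ (W.pt i) r₁ r₂) := measureReal_union_le _ _
    _ ≤ (triSitePercolation half).real {ω | Φ ω ∈ discreteCrossing Q.carrier δ (Q.arc 0) (Q.arc 2)} +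
          ∑ i : Fin 4, (triSitePercolation half).real (triAnnulusCrossing true δ (W.pt i) r₁ r₂) := by
        gcongr
        exact measureReal_iUnion_fintype_le _

/-- **Upper half of (19) with corner terms, cell/site version** (see the module docstring; Lemma 5:
no closed crossing from arc `1` to arc `3` forces an open one from arc `0` to arc `2`).
[cite: BollobasRiordan2006, Ch. 7 Lemma 14 (19), Claims 19–20 p. 192, p. 195, Lemma 5] -/
theorem cell_le_openCrossingProb_add {ρ : ℝ}
    (hU : ∃ δ₀ > 0, ∃ t₀ > 0, ∀ δ t : ℝ, 0 < δ → δ < δ₀ → 0 ≤ t → t ≤ t₀ →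
      ∀ (p : unitInterval) (V U₁ U₃ : Set (Site 2)),
        (∀ x ∈ V, triMeshPoint δ x ∉ W.carrier →
          infDist (triMeshPoint δ x) (W.arc 1) ≤ t ∨ infDist (triMeshPoint δ x) (W.arc 3) ≤ t) →
        (∀ x ∈ V, triMeshPoint δ x ∈ W.carrier →
          8 * δ < infDist (triMeshPoint δ x) (W.arc 0) ∧ 8 * δ < infDist (triMeshPoint δ x) (W.arc 2)) →
        (∀ x ∈ V, ∀ j : Fin 4, ρ ≤ dist (triMeshPoint δ x) (W.pt j)) →
        (∀ u ∈ U₁, 4 * δ ≤ infDist (triMeshPoint δ u) W.carrier ∧ infDist (triMeshPoint δ u) (W.arc 1) ≤ t) →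
        (∀ v ∈ U₃, 4 * δ ≤ infDist (triMeshPoint δ v) W.carrier ∧ infDist (triMeshPoint δ v) (W.arc 3) ≤ t) →
        (triSitePercolation p).real {ω | Φ ω ∈ discreteCrossing Q.carrier δ (Q.arc 0) (Q.arc 2)} ≤
          (triSitePercolation p).real {ω | ¬ ∃ u ∈ U₁, ∃ v ∈ U₃, PathIn triGraph (V ∩ ωᶜ) u v}) :
    ∃ δ₀ > 0, ∃ t₀ > 0, ∀ δ t : ℝ, 0 < δ → δ < δ₀ → 0 ≤ t → t ≤ t₀ → ∀ {r₁ r₂ : ℝ}, ρ ≤ r₁ →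
      ∀ G : TriMarkedDomain 4,
        (∀ x ∈ G.verts, triMeshPoint δ x ∉ W.carrier →
          infDist (triMeshPoint δ x) (W.arc 1) ≤ t ∨ infDist (triMeshPoint δ x) (W.arc 3) ≤ t) →
        (∀ x ∈ G.verts, triMeshPoint δ x ∈ W.carrier → (∀ i, ρ ≤ dist (triMeshPoint δ x) (W.pt i)) →
          8 * δ < infDist (triMeshPoint δ x) (W.arc 0) ∧ 8 * δ < infDist (triMeshPoint δ x) (W.arc 2)) →
        (∀ u ∈ G.arc 1, (∀ i, ρ ≤ dist (triMeshPoint δ u) (W.pt i)) →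
          4 * δ ≤ infDist (triMeshPoint δ u) W.carrier ∧ infDist (triMeshPoint δ u) (W.arc 1) ≤ t) →
        (∀ v ∈ G.arc 3, (∀ i, ρ ≤ dist (triMeshPoint δ v) (W.pt i)) →
          4 * δ ≤ infDist (triMeshPoint δ v) W.carrier ∧ infDist (triMeshPoint δ v) (W.arc 3) ≤ t) →
        (∀ u ∈ G.arc 1, r₂ < dist (triMeshPoint δ u) (W.pt 3) ∧ r₂ < dist (triMeshPoint δ u) (W.pt 0)) →
        (∀ v ∈ G.arc 3, r₂ < dist (triMeshPoint δ v) (W.pt 1) ∧ r₂ < dist (triMeshPoint δ v) (W.pt 2)) →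
        (triSitePercolation half).real {ω | Φ ω ∈ discreteCrossing Q.carrier δ (Q.arc 0) (Q.arc 2)} ≤
          G.openCrossingProb 0 2 +
            ∑ i : Fin 4, (triSitePercolation half).real (triAnnulusCrossing false δ (W.pt i) r₁ r₂) := by
  classical
  obtain ⟨δ₀, hδ₀, t₀, ht₀, hsand⟩ := hU
  refine ⟨δ₀, hδ₀, t₀, ht₀, fun δ t hδ hδlt ht htle r₁ r₂ hρ G hout hin hU₁ hU₃ hfar1 hfar3 => ?_⟩
  set V : Set (Site 2) := {x | x ∈ G.verts ∧ ∀ i, ρ ≤ dist (triMeshPoint δ x) (W.pt i)} with hV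
  set U₁ : Set (Site 2) := {u | u ∈ G.arc 1 ∧ ∀ i, ρ ≤ dist (triMeshPoint δ u) (W.pt i)} with hU₁def
  set U₃ : Set (Site 2) := {v | v ∈ G.arc 3 ∧ ∀ i, ρ ≤ dist (triMeshPoint δ v) (W.pt i)} with hU₃def
  have hle := hsand δ t hδ hδlt ht htle half V U₁ U₃ (fun x hx => hout x hx.1) (fun x hx hxΩ => hin x hx.1 hxΩ hx.2)
    (fun x hx => hx.2) (fun u hu => hU₁ u hu.1 hu.2) (fun v hv => hU₃ v hv.1 hv.2)
  have hsub : {ω : SiteConfig (Site 2) | ¬ ∃ u ∈ U₁, ∃ v ∈ U₃, PathIn triGraph (V ∩ ωᶜ) u v} ⊆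
      G.openCrossing 0 2 ∪ ⋃ i : Fin 4, triAnnulusCrossing false δ (W.pt i) r₁ r₂ := by
    intro ω hω
    by_cases hcl : G.IsClosedCrossing ω 1 3
    · obtain ⟨u, hu, v, hv, hP⟩ := hcl
      obtain ⟨P, hP⟩ := hP.exists_walk
      have hend : ∀ i : Fin 4, r₂ < dist (triMeshPoint δ u) (W.pt i) ∨ r₂ < dist (triMeshPoint δ v) (W.pt i) := by
        intro i
        match i with
        | 0 => exact Or.inl (hfar1 u hu).2
        | 1 => exact Or.inr (hfar3 v hv).1
        | 2 => exact Or.inr (hfar3 v hv).2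
        | 3 => exact Or.inl (hfar1 u hu).1
      rcases walk_far_or_annulus W hρ (c := false) (ω := ω) P (fun x hx => by simpa using (hP x hx).2) hend
        with hfar | ⟨i, hi⟩
      · exfalso
        refine hω ⟨u, ⟨hu, fun i => hfar u P.start_mem_support i⟩, v, ⟨hv, fun i => hfar v P.end_mem_support i⟩, ?_⟩
        exact PathIn.of_walk P fun x hx => ⟨⟨(hP x hx).1, fun i => hfar x hx i⟩, (hP x hx).2⟩
      · exact Or.inr (mem_iUnion.2 ⟨i, hi⟩)
    · exact Or.inl (((tri_markedDomain_duality_holds G ω).or).resolve_right hcl)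
  calc (triSitePercolation half).real {ω | Φ ω ∈ discreteCrossing Q.carrier δ (Q.arc 0) (Q.arc 2)}
      ≤ (triSitePercolation half).real {ω | ¬ ∃ u ∈ U₁, ∃ v ∈ U₃, PathIn triGraph (V ∩ ωᶜ) u v} := hle
    _ ≤ (triSitePercolation half).real (G.openCrossing 0 2 ∪ ⋃ i : Fin 4, triAnnulusCrossing false δ (W.pt i) r₁ r₂) :=
        measureReal_mono hsub (measure_ne_top _ _)
    _ ≤ (triSitePercolation half).real (G.openCrossing 0 2) +
          (triSitePercolation half).real (⋃ i : Fin 4, triAnnulusCrossing false δ (W.pt i) r₁ r₂) := measureReal_union_le _ _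
    _ ≤ G.openCrossingProb 0 2 + ∑ i : Fin 4, (triSitePercolation half).real (triAnnulusCrossing false δ (W.pt i) r₁ r₂) := by
        gcongr
        · exact le_rfl
        · exact measureReal_iUnion_fintype_le _

end Summit.CriticalPhenomena.CardyFormulaZ2.Theorems.SmirnovCellAnchor

end
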